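import Summits.Ventures.PercRepro.MSTightCompletionCoords

/-!
# The fibres of `Y` and of `K` over the rows of a tight completion (shape A)

Dossier proofs/MINE1-theoremS.md, Addendum 57 §2 and suppl. 4; HANDOFF §mine-1 gen 32 → 33, step
(K2). In the coordinates of `MSTightCompletionCoords.lean` (`F₀ = L ⊻ U₀`, `P = L ⊻ U`,
`M = cM r F`), the type-I differences `Y = diffsY r F = F₁ \\ F₀` and the partner family
`K = partner r F` decompose over the rows `x ∈ L`:

* `fibre M Y x = {z ⊆ M : x ∪ z ∈ Y}` and **`|Y| = Σ_{x ∈ L} |fibre M Y x|`**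
  (`card_eq_sum_card_fibre`, `card_diffsY_eq_sum_fibre`), likewise `|K| = Σ_x |K^x|`
  (`card_partner_eq_sum_fibre`);
* the row inclusion `(M − U₀) ∩ ↓((U ∖ U₀) ∪ K^x) ⊆ Z^x` (`filter_complWithin_subset_fibre`):
  a lost-or-not column `z = M ∖ y` below a partnerless `r`-member column or a partner column of
  the row is the difference `(x ∪ g) ∖ y ∈ Y`;
* every row has `|Z^x| ≥ |K^x|` (`card_fibre_partner_le_card_fibre_diffsY`, through
  `D(K^x) ⊆ (M − U₀) ∩ ↓K^x` and Marica–Schönheim), and a FULL row (`M ∈ K^x`) has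
  `Z^x = M − U₀` (`card_cU0_le_card_fibre_of_cM_mem`).

The strict bound `|Z^x| ≥ |K^x| + 1` of a non-full row (Lemma X within `M`) and the row lemma
(ROW-a) are step (K3).
-/

namespace PercRepro.MSTight

open Finset
open scoped FinsetFamily

variable {α : Type*} [DecidableEq α] [Fintype α] {F : Finset (Finset α)} {r : α}

section Fibre

omit [Fintype α] in
/-- The fibre of a family `Y` over `x`: the subsets `z ⊆ M` with `x ∪ z ∈ Y`. -/
def fibre (M : Finset α) (Y : Finset (Finset α)) (x : Finset α) : Finset (Finset α) :=
  M.powerset.filter fun z => x ∪ z ∈ Y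

omit [Fintype α] in
/-- Membership in a fibre. -/
theorem mem_fibre {M x z : Finset α} {Y : Finset (Finset α)} :
    z ∈ fibre M Y x ↔ z ⊆ M ∧ x ∪ z ∈ Y := by
  simp [fibre]

omit [Fintype α] in
/-- **Fibre counting**: if every member `w` of `Y` has `w ∖ M ∈ L` and the members of `L` are
disjoint from `M`, then `|Y| = Σ_{x ∈ L} |fibre M Y x|`. -/
theorem card_eq_sum_card_fibre {L Y : Finset (Finset α)} {M : Finset α}
    (hL : ∀ x ∈ L, Disjoint x M) (hY : ∀ w ∈ Y, w \ M ∈ L) :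
    Y.card = ∑ x ∈ L, (fibre M Y x).card := by
  rw [card_eq_sum_card_fiberwise hY]
  refine sum_congr rfl fun x hx => ?_
  apply card_bij (fun w _ => w ∩ M)
  · intro w hw
    obtain ⟨hwY, hwx⟩ := mem_filter.1 hw
    refine mem_fibre.2 ⟨inter_subset_right, ?_⟩
    rw [← hwx, sdiff_union_inter]
    exact hwY
  · intro w hw w' hw' h
    obtain ⟨-, hwx⟩ := mem_filter.1 hw
    obtain ⟨-, hw'x⟩ := mem_filter.1 hw'
    rw [← sdiff_union_inter w M, ← sdiff_union_inter w' M, hwx, hw'x, h]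
  · intro z hz
    obtain ⟨hzM, hz⟩ := mem_fibre.1 hz
    refine ⟨x ∪ z, mem_filter.2 ⟨hz, ?_⟩, ?_⟩
    · rw [union_sdiff_distrib, sdiff_eq_empty_iff_subset.2 hzM, union_empty,
        (hL x hx).sdiff_eq_left]
    · rw [union_inter_distrib_right, Finset.disjoint_iff_inter_eq_empty.1 (hL x hx), empty_union,
        inter_eq_left.2 hzM]

omit [Fintype α] in
/-- The complements within `M` of a family of subsets of `M` are as many as its members. -/
theorem card_complWithin {M : Finset α} {H : Finset (Finset α)} (hH : ∀ y ∈ H, y ⊆ M) :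
    (complWithin M H).card = H.card := by
  unfold complWithin
  apply card_image_of_injOn
  intro y hy y' hy' h
  simp only at h
  rw [← Finset.sdiff_sdiff_eq_self (hH y hy), h, Finset.sdiff_sdiff_eq_self (hH y' hy')]

end Fibre

section Rows

/-- The `N`-part of a type-I difference lies in `L`. -/
theorem sdiff_cM_mem_cL_of_mem_diffsY (htw : ∀ a b, Twin F a b → a = b)
    (hcore : ∀ a, ∃ t ∈ F, a ∉ t) (hC : Tight (completion0 r F)) {w : Finset α}
    (hw : w ∈ diffsY r F) : w \ cM r F ∈ cL r F := by
  obtain ⟨t, ht, s, -, rfl⟩ := mem_diffs.1 hw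
  exact isDownSet_cL htw hcore hC _
    (sdiff_cM_mem_cL_of_mem_proj htw hcore hC (mem_proj_of_mem_partr ht)) _
    (sdiff_subset_sdiff sdiff_subset (Subset.refl _))

/-- The `N`-part of a partner member lies in `L`. -/
theorem sdiff_cM_mem_cL_of_mem_partner (htw : ∀ a b, Twin F a b → a = b)
    (hcore : ∀ a, ∃ t ∈ F, a ∉ t) (hC : Tight (completion0 r F)) {k : Finset α}
    (hk : k ∈ partner r F) : k \ cM r F ∈ cL r F :=
  sdiff_cM_mem_cL_of_mem_proj htw hcore hC (mem_proj_of_mem_part0 (inter_subset_left hk))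

/-- **`|Y| = Σ_{x ∈ L} |Z^x|`** — the fibre identity for the type-I differences. -/
theorem card_diffsY_eq_sum_fibre (htw : ∀ a b, Twin F a b → a = b)
    (hcore : ∀ a, ∃ t ∈ F, a ∉ t) (hC : Tight (completion0 r F)) :
    (diffsY r F).card = ∑ x ∈ cL r F, (fibre (cM r F) (diffsY r F) x).card :=
  card_eq_sum_card_fibre (fun _ hx => disjoint_cM_of_mem_cL hx)
    (fun _ hw => sdiff_cM_mem_cL_of_mem_diffsY htw hcore hC hw)

/-- **`|K| = Σ_{x ∈ L} |K^x|`** — the fibre identity for the partner family. -/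
theorem card_partner_eq_sum_fibre (htw : ∀ a b, Twin F a b → a = b)
    (hcore : ∀ a, ∃ t ∈ F, a ∉ t) (hC : Tight (completion0 r F)) :
    (partner r F).card = ∑ x ∈ cL r F, (fibre (cM r F) (partner r F) x).card :=
  card_eq_sum_card_fibre (fun _ hx => disjoint_cM_of_mem_cL hx)
    (fun _ hk => sdiff_cM_mem_cL_of_mem_partner htw hcore hC hk)

/-- The columns of the partner members of a row lie in `U₀`. -/
theorem fibre_partner_subset_cU0 (htw : ∀ a b, Twin F a b → a = b)
    (hcore : ∀ a, ∃ t ∈ F, a ∉ t) (hC : Tight (completion0 r F)) {x : Finset α} (hx : x ∈ cL r F) :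
    fibre (cM r F) (partner r F) x ⊆ cU0 r F := by
  intro y hy
  obtain ⟨hyM, hy⟩ := mem_fibre.1 hy
  exact mem_cU0_of_union_mem_part0 htw hcore hC hx hyM (inter_subset_left hy)

/-- A partnerless column over a row gives an `r`-member: `x ∪ g ∈ F₁` for `x ∈ L`,
`g ∈ U ∖ U₀`. -/
theorem union_mem_partr_of_mem_sdiff (htw : ∀ a b, Twin F a b → a = b)
    (hcore : ∀ a, ∃ t ∈ F, a ∉ t) (hC : Tight (completion0 r F)) {x g : Finset α} (hx : x ∈ cL r F)
    (hg : g ∈ cU r F \ cU0 r F) : x ∪ g ∈ partr r F := by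
  obtain ⟨hgU, hgU0⟩ := mem_sdiff.1 hg
  have hP : x ∪ g ∈ proj r F := union_mem_proj htw hcore hC hx hgU
  rw [proj_eq_union, mem_union] at hP
  rcases hP with h | h
  · exact absurd (mem_cU0_of_union_mem_part0 htw hcore hC hx (subset_cM_of_mem_cU hgU) h) hgU0
  · exact h

omit [Fintype α] in
/-- `(x ∪ g) ∖ y = x ∪ (M ∖ y)` for `x` disjoint from `M`, `y ⊆ M` and `M ∖ y ⊆ g ⊆ M`. -/
theorem union_sdiff_eq_union_sdiff {M x y g : Finset α} (hxM : Disjoint x M) (hyM : y ⊆ M)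
    (hgM : g ⊆ M) (hzg : M \ y ⊆ g) : (x ∪ g) \ y = x ∪ (M \ y) := by
  ext a
  simp only [mem_sdiff, mem_union]
  constructor
  · rintro ⟨h | h, hay⟩
    · exact Or.inl h
    · exact Or.inr ⟨hgM h, hay⟩
  · rintro (h | ⟨haM, hay⟩)
    · exact ⟨Or.inl h, fun hay => disjoint_left.1 hxM h (hyM hay)⟩
    · exact ⟨Or.inr (hzg (mem_sdiff.2 ⟨haM, hay⟩)), hay⟩

/-- **The row inclusion**: a column `M ∖ y` (`y ∈ U₀`) below a partnerless `r`-member column or a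
partner column of the row `x` lies in the fibre of `Y` over `x`. -/
theorem union_sdiff_mem_diffsY (htw : ∀ a b, Twin F a b → a = b)
    (hcore : ∀ a, ∃ t ∈ F, a ∉ t) (hC : Tight (completion0 r F)) {x y g : Finset α}
    (hx : x ∈ cL r F) (hy : y ∈ cU0 r F)
    (hg : g ∈ cU r F \ cU0 r F ∪ fibre (cM r F) (partner r F) x) (hzg : cM r F \ y ⊆ g) :
    x ∪ (cM r F \ y) ∈ diffsY r F := by
  have hyM := subset_cM_of_mem_cU0 hy
  have hs : y ∈ part0 r F := by
    have := union_mem_part0 htw hcore hC (empty_mem_cL hcore) hy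
    rwa [empty_union] at this
  have hgM : g ⊆ cM r F := by
    rcases mem_union.1 hg with h | h
    · exact subset_cM_of_mem_cU (mem_sdiff.1 h).1
    · exact (mem_fibre.1 h).1
  have ht : x ∪ g ∈ partr r F := by
    rcases mem_union.1 hg with h | h
    · exact union_mem_partr_of_mem_sdiff htw hcore hC hx h
    · exact inter_subset_right (mem_fibre.1 h).2
  refine mem_diffs.2 ⟨x ∪ g, ht, y, hs, ?_⟩
  exact union_sdiff_eq_union_sdiff (disjoint_cM_of_mem_cL hx) hyM hgM hzg

/-- **The row inclusion, as families**: `(M − U₀) ∩ ↓((U ∖ U₀) ∪ K^x) ⊆ Z^x`. -/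
theorem filter_complWithin_subset_fibre (htw : ∀ a b, Twin F a b → a = b)
    (hcore : ∀ a, ∃ t ∈ F, a ∉ t) (hC : Tight (completion0 r F)) {x : Finset α} (hx : x ∈ cL r F) :
    (complWithin (cM r F) (cU0 r F)).filter
        (fun z => ∃ g ∈ cU r F \ cU0 r F ∪ fibre (cM r F) (partner r F) x, z ⊆ g) ⊆
      fibre (cM r F) (diffsY r F) x := by
  intro z hz
  obtain ⟨hz, g, hg, hzg⟩ := mem_filter.1 hz
  obtain ⟨y, hy, rfl⟩ := mem_complWithin.1 hz
  exact mem_fibre.2 ⟨sdiff_subset, union_sdiff_mem_diffsY htw hcore hC hx hy hg hzg⟩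

/-- A FULL row (`M ∈ K^x`) has `M − U₀ ⊆ Z^x`. -/
theorem complWithin_subset_fibre_of_cM_mem (htw : ∀ a b, Twin F a b → a = b)
    (hcore : ∀ a, ∃ t ∈ F, a ∉ t) (hC : Tight (completion0 r F)) {x : Finset α} (hx : x ∈ cL r F)
    (hM : cM r F ∈ fibre (cM r F) (partner r F) x) :
    complWithin (cM r F) (cU0 r F) ⊆ fibre (cM r F) (diffsY r F) x := by
  intro z hz
  refine filter_complWithin_subset_fibre htw hcore hC hx (mem_filter.2 ⟨hz, cM r F, ?_, ?_⟩)
  · exact mem_union_right _ hM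
  · obtain ⟨y, -, rfl⟩ := mem_complWithin.1 hz
    exact sdiff_subset

/-- A FULL row has `|Z^x| ≥ |U₀|`. -/
theorem card_cU0_le_card_fibre_of_cM_mem (htw : ∀ a b, Twin F a b → a = b)
    (hcore : ∀ a, ∃ t ∈ F, a ∉ t) (hC : Tight (completion0 r F)) {x : Finset α} (hx : x ∈ cL r F)
    (hM : cM r F ∈ fibre (cM r F) (partner r F) x) :
    (cU0 r F).card ≤ (fibre (cM r F) (diffsY r F) x).card := by
  rw [← card_complWithin (fun _ hy => subset_cM_of_mem_cU0 hy)]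
  exact card_le_card (complWithin_subset_fibre_of_cM_mem htw hcore hC hx hM)

/-- The differences of the partner columns of a row lie in `(M − U₀) ∩ ↓K^x`. -/
theorem diffs_fibre_partner_subset (htw : ∀ a b, Twin F a b → a = b)
    (hcore : ∀ a, ∃ t ∈ F, a ∉ t) (hC : Tight (completion0 r F)) {x : Finset α} (hx : x ∈ cL r F) :
    fibre (cM r F) (partner r F) x \\ fibre (cM r F) (partner r F) x ⊆
      (complWithin (cM r F) (cU0 r F)).filter
        (fun z => ∃ g ∈ cU r F \ cU0 r F ∪ fibre (cM r F) (partner r F) x, z ⊆ g) := by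
  intro z hz
  obtain ⟨y, hy, y', hy', rfl⟩ := mem_diffs.1 hz
  have hyM : y ⊆ cM r F := (mem_fibre.1 hy).1
  have hy'U0 : y' ∈ cU0 r F := fibre_partner_subset_cU0 htw hcore hC hx hy'
  refine mem_filter.2 ⟨mem_complWithin.2 ⟨y' ∪ (cM r F \ y), ?_, ?_⟩, y, mem_union_right _ hy,
    sdiff_subset⟩
  · exact isUpSetWithin_cU0 htw hcore hC _ hy'U0 _
      (union_subset (subset_cM_of_mem_cU0 hy'U0) sdiff_subset) subset_union_left
  · ext a
    simp only [mem_sdiff, mem_union, not_or, not_and, not_not]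
    constructor
    · rintro ⟨haM, hay', hay⟩
      exact ⟨hay haM, hay'⟩
    · rintro ⟨hay, hay'⟩
      exact ⟨hyM hay, hay', fun _ => hay⟩

/-- **Every row has `|Z^x| ≥ |K^x|`** (Marica–Schönheim on the partner columns of the row). -/
theorem card_fibre_partner_le_card_fibre_diffsY (htw : ∀ a b, Twin F a b → a = b)
    (hcore : ∀ a, ∃ t ∈ F, a ∉ t) (hC : Tight (completion0 r F)) {x : Finset α}
    (hx : x ∈ cL r F) :
    (fibre (cM r F) (partner r F) x).card ≤ (fibre (cM r F) (diffsY r F) x).card :=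
  (card_le_card_diffs _).trans ((card_le_card (diffs_fibre_partner_subset htw hcore hC hx)).trans
    (card_le_card (filter_complWithin_subset_fibre htw hcore hC hx)))

end Rows

end PercRepro.MSTight
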